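import Mathlib
import HarnessLib
import Literature.Probability.MarkovChains.ReturnTimeTransienceCriterion

/-!
# Abel convergence: `R(s) = (1−s) Σₙ sⁿPⁿ`, the identity `R(s)_{ij} = (1−s)δ_{ij} + f̂(s)_{ij}R(s)_{jj}` and the Abel limits `π_{jj} = 1/E[ρ_j | X_0 = j]` (Stroock 2014, §4.1.2)

HONEST FRAMING: exact (Metropolis-corrected) sampling algorithms for lattice gauge theory; figures
of merit are autocorrelation/cost numbers at stated couplings and volumes; no continuum-physics claim.

SOURCE (read on the hub's materialised pages): D. W. Stroock, *An Introduction to Markov Processes*,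
2nd ed., GTM **230**, Springer 2014 [Stroock2014], §4.1.2 "Abel Convergence", eqs. (4.1.4)–(4.1.7),
and the first sentence of §4.1.3 ("if `μ` is stationary, then `μ = μR(s)`").

The book works on a countable state space with the norms `‖·‖_{u,v}` of §4.1.1; here the state
space is FINITE (the tree's `Matrix X X ℝ` chains), so (4.1.4) converges entrywise by comparison
with the geometric series and §4.1.1 is not needed.  Everything is PROVED (0 named facts).

* `abelResolvent P s = R(s)` **(4.1.4)**, a transition probability matrix for `s ∈ [0,1)`
  (`isRowStochastic_abelResolvent`), fixed by every stationary vector (`vecMul_abelResolvent`);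
* `returnTimeGF P j s k = f̂(s)_{kj} = E[s^{ρ_j} | X_0 = k] = Σ_{m≥1} sᵐ f(m)_{kj}` with
  `f̂(s) ≤ s`, `f̂(1)_{kj} = P(ρ_j < ∞ | X_0 = k)`, `f̂(s) → f̂(1)` as `s ↗ 1`;
* **(4.1.7)** `Stroock2014_eq_4_1_7` and `abelResolvent_diag = (1−s)/(1 − f̂(s)_{jj})`,
  `abelResolvent_offDiag = f̂(s)_{ij}R(s)_{jj}`;
* **(4.1.5)**: `Stroock2014_eq_4_1_5_transient` (`P(ρ_j = ∞ | X_0 = j) > 0 ⟹ R(s)_{jj} → 0`),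
  `Stroock2014_eq_4_1_5_posRecurrent` (`j` recurrent with `E[ρ_j | X_0 = j] = Σ m f(m)_{jj} = E
  < ∞ ⟹ R(s)_{jj} → E⁻¹`, through the monotone identity
  `(1 − f̂(s)_{jj})/(1 − s) = Σ_m f(m)_{jj} Σ_{ℓ<m} s^ℓ ↗ Σ_m m f(m)_{jj}`),
  `Stroock2014_eq_4_1_5_nullRecurrent` (the formal case `Σ m f(m) = ∞ ⟹ R(s)_{jj} → 0`, vacuous
  for finite chains but part of the printed dichotomy), `Stroock2014_eq_4_1_5_offDiag`
  (`R(s)_{ij} → P(ρ_j < ∞ | X_0 = i)·π_{jj}` for `i ≠ j`).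

Vocabulary reused, not restated: `firstPassageProb` and the renewal equation (4.1.6)
(`DoeblinKacFormula.lean`), `noReturnProb = P(ρ_j = ∞ | ·)` and `hasSum_firstPassageProb`
(`ReturnTimeTransienceCriterion.lean`), `IsRowStochastic`, `IsStationary`.  Not here: the scalar
lemmas "convergence ⟹ Abel convergence" and Exercise 4.2.1 (Cesàro ⟹ Abel; a separate file),
§4.1.1 (the `‖·‖_{u,v}` completeness), §4.1.3 (4.1.8)–Theorem 4.1.10 (structure of `Stat(P)`).
-/

namespace Literature.Probability.MarkovChains

open Finset Matrix Filter Topology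

variable {X : Type*} [Fintype X] [DecidableEq X]

/-! ## `R(s)` (4.1.4) -/

/-- **`R(s) = (1−s) Σ_{n≥0} sⁿ Pⁿ`** (entrywise series). [cite: Stroock2014, §4.1.2 eq. (4.1.4)] -/
noncomputable def abelResolvent (P : Matrix X X ℝ) (s : ℝ) : Matrix X X ℝ :=
  fun i j => (1 - s) * ∑' n : ℕ, s ^ n * (P ^ n) i j

omit [DecidableEq X] in
/-- Entries of a transition probability matrix are `≤ 1` (each row is a probability vector).
[cite: Stroock2014, §2.1.2 (transition probability matrices)] -/
private theorem apply_le_one_of_isRowStochastic {Q : Matrix X X ℝ} (hQ : IsRowStochastic Q)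
    (i j : X) : Q i j ≤ 1 := by
  calc Q i j ≤ ∑ k, Q i k := single_le_sum (f := fun k => Q i k) (fun k _ => hQ.1 i k) (mem_univ j)
    _ = 1 := hQ.2 i

/-- The series in (4.1.4) converges (entrywise, `0 ≤ sⁿ(Pⁿ)_{ij} ≤ sⁿ`), `s ∈ [0,1)`.
[cite: Stroock2014, §4.1.2 (the display after (4.1.4): "`‖Pⁿ‖_{u,v} = 1` … `≤ sᵐ`")] -/
theorem summable_abelResolventTerm {P : Matrix X X ℝ} (hP : IsRowStochastic P) {s : ℝ} (hs0 : 0 ≤ s)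
    (hs1 : s < 1) (i j : X) : Summable fun n : ℕ => s ^ n * (P ^ n) i j :=
  Summable.of_nonneg_of_le (fun n => mul_nonneg (pow_nonneg hs0 n) ((hP.matPow n).1 i j))
    (fun n => mul_le_of_le_one_right (pow_nonneg hs0 n)
      (apply_le_one_of_isRowStochastic (hP.matPow n) i j))
    (summable_geometric_of_lt_one hs0 hs1)

/-- `R(s)_{ij} ≥ 0`. [cite: Stroock2014, §4.1.2 eq. (4.1.4)] -/
theorem abelResolvent_nonneg {P : Matrix X X ℝ} (hP : IsRowStochastic P) {s : ℝ} (hs0 : 0 ≤ s)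
    (hs1 : s < 1) (i j : X) : 0 ≤ abelResolvent P s i j :=
  mul_nonneg (sub_nonneg.mpr hs1.le)
    (tsum_nonneg fun n => mul_nonneg (pow_nonneg hs0 n) ((hP.matPow n).1 i j))

/-- Row sums of `R(s)` are `(1−s) Σ sⁿ = 1`. [cite: Stroock2014, §4.1.2 eq. (4.1.4) (with
"`Pⁿ` is a transition probability matrix for each `n ≥ 0`")] -/
theorem sum_abelResolvent {P : Matrix X X ℝ} (hP : IsRowStochastic P) {s : ℝ} (hs0 : 0 ≤ s)
    (hs1 : s < 1) (i : X) : ∑ j, abelResolvent P s i j = 1 := by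
  unfold abelResolvent
  rw [← mul_sum, ← Summable.tsum_finsetSum fun j _ => summable_abelResolventTerm hP hs0 hs1 i j]
  have h : ∀ n : ℕ, ∑ j, s ^ n * (P ^ n) i j = s ^ n := fun n => by
    rw [← mul_sum, (hP.matPow n).2 i, mul_one]
  simp_rw [h]
  rw [tsum_geometric_of_lt_one hs0 hs1, mul_inv_cancel₀ (sub_pos.mpr hs1).ne']

/-- **`R(s)` is a transition probability matrix** for `s ∈ [0,1)`. [cite: Stroock2014, §4.1.2
eq. (4.1.4)] -/
theorem isRowStochastic_abelResolvent {P : Matrix X X ℝ} (hP : IsRowStochastic P) {s : ℝ}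
    (hs0 : 0 ≤ s) (hs1 : s < 1) : IsRowStochastic (abelResolvent P s) :=
  ⟨abelResolvent_nonneg hP hs0 hs1, sum_abelResolvent hP hs0 hs1⟩

/-- **A stationary vector is `R(s)`-stationary**: `μ = μP ⟹ μ = μR(s)`. [cite: Stroock2014, §4.1.3
("Obviously, if `μ` is stationary, then `μ = μR(s)` for each `s ∈ [0,1)`")] -/
theorem sum_mul_abelResolvent_of_isStationary {P : Matrix X X ℝ} (hP : IsRowStochastic P)
    {μ : X → ℝ} (hμ : IsStationary μ P) {s : ℝ} (hs0 : 0 ≤ s) (hs1 : s < 1) (j : X) :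
    ∑ i, μ i * abelResolvent P s i j = μ j := by
  have hpow : ∀ (n : ℕ) (y : X), ∑ i, μ i * (P ^ n) i y = μ y := by
    intro n
    induction n with
    | zero => intro y; simp [one_apply]
    | succ n ih =>
      intro y
      simp_rw [pow_succ, mul_apply, mul_sum, ← mul_assoc]
      rw [sum_comm]
      simp_rw [← sum_mul, ih]
      exact hμ y
  unfold abelResolvent
  have h1 : ∀ i, μ i * ((1 - s) * ∑' n : ℕ, s ^ n * (P ^ n) i j) =
      ∑' n : ℕ, (1 - s) * (s ^ n * (μ i * (P ^ n) i j)) := fun i => by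
    rw [← tsum_mul_left, ← tsum_mul_left]; exact tsum_congr fun n => by ring
  simp_rw [h1]
  rw [← Summable.tsum_finsetSum fun i _ =>
    ((summable_abelResolventTerm hP hs0 hs1 i j).mul_left (μ i)).mul_left (1 - s) |>.congr fun n => by ring]
  have h2 : ∀ n : ℕ, ∑ i, (1 - s) * (s ^ n * (μ i * (P ^ n) i j)) = (1 - s) * μ j * s ^ n :=
    fun n => by rw [← mul_sum, ← mul_sum, hpow n j]; ring
  simp_rw [h2]
  rw [tsum_mul_left, tsum_geometric_of_lt_one hs0 hs1, mul_assoc, mul_comm (μ j), ← mul_assoc,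
    mul_inv_cancel₀ (sub_pos.mpr hs1).ne', one_mul]

/-! ## `f̂(s)` -/

/-- **`f̂(s)_{kj} = Σ_{m≥1} sᵐ f(m)_{kj} = E[s^{ρ_j} | X_0 = k]`** (the `m = 0` term is `0`).
[cite: Stroock2014, §4.1.2 (the display before (4.1.7))] -/
noncomputable def returnTimeGF (P : Matrix X X ℝ) (j : X) (s : ℝ) (k : X) : ℝ :=
  ∑' m : ℕ, s ^ m * firstPassageProb P j m k

/-- The series `Σ sᵐ f(m)_{kj}` converges for `s ∈ [0,1]` (dominated by `Σ f(m) ≤ 1`).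
[cite: Stroock2014, §4.1.2 (definition of `f̂(s)`)] -/
theorem summable_returnTimeGF_term {P : Matrix X X ℝ} (hP : IsRowStochastic P) (j : X) {s : ℝ}
    (hs0 : 0 ≤ s) (hs1 : s ≤ 1) (k : X) :
    Summable fun m : ℕ => s ^ m * firstPassageProb P j m k :=
  Summable.of_nonneg_of_le (fun m => mul_nonneg (pow_nonneg hs0 m) (firstPassageProb_nonneg hP j m k))
    (fun m => mul_le_of_le_one_left (firstPassageProb_nonneg hP j m k) (pow_le_one₀ hs0 hs1))
    (hasSum_firstPassageProb hP j k).summable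

/-- `f̂(s)_{kj} ≥ 0`. [cite: Stroock2014, §4.1.2 (definition of `f̂(s)`)] -/
theorem returnTimeGF_nonneg {P : Matrix X X ℝ} (hP : IsRowStochastic P) (j : X) {s : ℝ}
    (hs0 : 0 ≤ s) (k : X) : 0 ≤ returnTimeGF P j s k :=
  tsum_nonneg fun m => mul_nonneg (pow_nonneg hs0 m) (firstPassageProb_nonneg hP j m k)

/-- **`f̂(1)_{kj} = Σ_m f(m)_{kj} = P(ρ_j < ∞ | X_0 = k)`.** [cite: Stroock2014, §4.1.2
("if `j` is transient, and therefore `f̂(1)_{jj} < 1`")] -/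
theorem returnTimeGF_one {P : Matrix X X ℝ} (hP : IsRowStochastic P) (j k : X) :
    returnTimeGF P j 1 k = 1 - noReturnProb P j k := by
  unfold returnTimeGF
  simp_rw [one_pow, one_mul]
  exact (hasSum_firstPassageProb hP j k).tsum_eq

/-- `f̂(s)_{kj} ≤ s·P(ρ_j < ∞ | X_0 = k) ≤ s` for `s ∈ [0,1]` (`ρ_j ≥ 1`). [cite: Stroock2014,
§4.1.2 (definition of `f̂(s) = E[s^{ρ_j} | X_0 = i]`)] -/
theorem returnTimeGF_le {P : Matrix X X ℝ} (hP : IsRowStochastic P) (j : X) {s : ℝ}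
    (hs0 : 0 ≤ s) (hs1 : s ≤ 1) (k : X) :
    returnTimeGF P j s k ≤ s * (1 - noReturnProb P j k) := by
  unfold returnTimeGF
  rw [← ((hasSum_firstPassageProb hP j k).mul_left s).tsum_eq]
  refine (summable_returnTimeGF_term hP j hs0 hs1 k).tsum_le_tsum (fun m => ?_)
    ((hasSum_firstPassageProb hP j k).summable.mul_left s)
  rcases m with _ | m
  · simp [firstPassageProb_zero]
  · exact mul_le_mul_of_nonneg_right
      (by rw [pow_succ]; exact mul_le_of_le_one_left hs0 (pow_le_one₀ hs0 hs1))
      (firstPassageProb_nonneg hP j _ k)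

/-- `f̂(s)_{kj} ≤ s < 1` for `s ∈ [0,1)`. [cite: Stroock2014, §4.1.2 (definition of `f̂(s)`)] -/
theorem returnTimeGF_lt_one {P : Matrix X X ℝ} (hP : IsRowStochastic P) (j : X) {s : ℝ}
    (hs0 : 0 ≤ s) (hs1 : s < 1) (k : X) : returnTimeGF P j s k < 1 :=
  calc returnTimeGF P j s k ≤ s * (1 - noReturnProb P j k) := returnTimeGF_le hP j hs0 hs1.le k
    _ ≤ s * 1 := mul_le_mul_of_nonneg_left (by linarith [noReturnProb_nonneg hP j k]) hs0
    _ < 1 := by rw [mul_one]; exact hs1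

/-- **`f̂(s)_{kj} → f̂(1)_{kj} = P(ρ_j < ∞ | X_0 = k)` as `s ↗ 1`** (dominated convergence).
[cite: Stroock2014, §4.1.2 (the limits after (4.1.7))] -/
theorem tendsto_returnTimeGF {P : Matrix X X ℝ} (hP : IsRowStochastic P) (j k : X) :
    Tendsto (fun s => returnTimeGF P j s k) (𝓝[<] 1) (𝓝 (1 - noReturnProb P j k)) := by
  rw [← (hasSum_firstPassageProb hP j k).tsum_eq]
  refine tendsto_tsum_of_dominated_convergence (bound := fun m => firstPassageProb P j m k)
    (hasSum_firstPassageProb hP j k).summable (fun m => ?_) ?_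
  · have : Tendsto (fun s : ℝ => s ^ m * firstPassageProb P j m k) (𝓝 1)
        (𝓝 (1 ^ m * firstPassageProb P j m k)) :=
      ((continuous_pow m).tendsto 1).mul_const _
    rw [one_pow, one_mul] at this
    exact tendsto_nhdsWithin_of_tendsto_nhds this
  · filter_upwards [Ioo_mem_nhdsLT zero_lt_one] with s hs m
    rw [Real.norm_eq_abs, abs_of_nonneg (mul_nonneg (pow_nonneg hs.1.le m)
      (firstPassageProb_nonneg hP j m k))]
    exact mul_le_of_le_one_left (firstPassageProb_nonneg hP j m k) (pow_le_one₀ hs.1.le hs.2.le)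

/-! ## (4.1.7) -/

/-- **(4.1.7)**: `R(s)_{ij} = (1−s)δ_{ij} + f̂(s)_{ij} R(s)_{jj}` for `s ∈ [0,1)` (insert the renewal
equation (4.1.6) into (4.1.4) and exchange the sums). [cite: Stroock2014, §4.1.2 eq. (4.1.7)] -/
theorem Stroock2014_eq_4_1_7 {P : Matrix X X ℝ} (hP : IsRowStochastic P) {s : ℝ} (hs0 : 0 ≤ s)
    (hs1 : s < 1) (i j : X) :
    abelResolvent P s i j =
      (1 - s) * (if i = j then 1 else 0) + returnTimeGF P j s i * abelResolvent P s j j := by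
  set F : ℕ → ℝ := fun m => s ^ m * firstPassageProb P j m i with hF
  set G : ℕ → ℝ := fun n => s ^ n * (P ^ n) j j with hG
  set A : ℕ → ℝ := fun n => s ^ n * (P ^ n) i j with hA
  have hFs : Summable F := summable_returnTimeGF_term hP j hs0 hs1.le i
  have hGs : Summable G := summable_abelResolventTerm hP hs0 hs1 j j
  have hAs : Summable A := summable_abelResolventTerm hP hs0 hs1 i j
  have hF0 : ∀ m, 0 ≤ F m := fun m => mul_nonneg (pow_nonneg hs0 m) (firstPassageProb_nonneg hP j m i)
  have hG0 : ∀ n, 0 ≤ G n := fun n => mul_nonneg (pow_nonneg hs0 n) ((hP.matPow n).1 j j)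
  -- the Cauchy product, term by term
  have hc : ∀ n, ∑ k ∈ range (n + 1), F k * G (n - k) = if n = 0 then 0 else A n := by
    intro n
    split_ifs with hn
    · subst hn; simp [hF, firstPassageProb_zero]
    · rw [hA]; dsimp only
      rw [Stroock2014_eq_4_1_6' hP j hn i, mul_sum]
      refine sum_congr rfl fun k hk => ?_
      have hkn : k ≤ n := Nat.lt_succ_iff.mp (mem_range.mp hk)
      rw [hF, hG]; dsimp only
      rw [show s ^ n = s ^ k * s ^ (n - k) by rw [← pow_add, Nat.add_sub_cancel' hkn]]
      ring
  have hcauchy : (∑' m, F m) * ∑' n, G n = ∑' n, (if n = 0 then (0 : ℝ) else A n) := by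
    rw [tsum_mul_tsum_eq_tsum_sum_range_of_summable_norm
      (hFs.congr fun m => (Real.norm_of_nonneg (hF0 m)).symm)
      (hGs.congr fun n => (Real.norm_of_nonneg (hG0 n)).symm)]
    exact tsum_congr hc
  have hshift : Summable fun n => A (n + 1) := (summable_nat_add_iff 1).mpr hAs
  have hsumA : ∑' n, A n = (if i = j then 1 else 0) + (∑' m, F m) * ∑' n, G n := by
    rw [hcauchy, hAs.tsum_eq_zero_add, tsum_eq_zero_add' (f := fun n => if n = 0 then (0 : ℝ) else A n)
      (by simpa using hshift)]
    simp only [Nat.succ_ne_zero, if_true, if_false, zero_add, hA, pow_zero, one_mul, one_apply]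
  show (1 - s) * ∑' n, A n = (1 - s) * (if i = j then 1 else 0) + (∑' m, F m) * ((1 - s) * ∑' n, G n)
  rw [hsumA]; ring

/-- **`R(s)_{jj} = (1−s)/(1 − f̂(s)_{jj})`**, `s ∈ [0,1)`. [cite: Stroock2014, §4.1.2 (the display
after (4.1.7))] -/
theorem abelResolvent_diag {P : Matrix X X ℝ} (hP : IsRowStochastic P) {s : ℝ} (hs0 : 0 ≤ s)
    (hs1 : s < 1) (j : X) : abelResolvent P s j j = (1 - s) / (1 - returnTimeGF P j s j) := by
  have h := Stroock2014_eq_4_1_7 hP hs0 hs1 j j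
  rw [if_pos rfl, mul_one] at h
  rw [eq_div_iff (sub_pos.mpr (returnTimeGF_lt_one hP j hs0 hs1 j)).ne']
  linarith

/-- **`R(s)_{ij} = f̂(s)_{ij} R(s)_{jj}` for `i ≠ j`**, `s ∈ [0,1)`. [cite: Stroock2014, §4.1.2
eq. (4.1.7) (the case `i ≠ j`)] -/
theorem abelResolvent_offDiag {P : Matrix X X ℝ} (hP : IsRowStochastic P) {s : ℝ} (hs0 : 0 ≤ s)
    (hs1 : s < 1) {i j : X} (hij : i ≠ j) :
    abelResolvent P s i j = returnTimeGF P j s i * abelResolvent P s j j := by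
  rw [Stroock2014_eq_4_1_7 hP hs0 hs1 i j, if_neg hij, mul_zero, zero_add]

/-! ## (4.1.5): the Abel limits -/

/-- **(4.1.5), transient case**: if `P(ρ_j = ∞ | X_0 = j) > 0` then `R(s)_{jj} → 0 = π_{jj}` as
`s ↗ 1` (`f̂(1)_{jj} < 1`). [cite: Stroock2014, §4.1.2 eq. (4.1.5) ("if `j` is transient …
`π_{jj} = lim R(s)_{jj} = 0`")] -/
theorem Stroock2014_eq_4_1_5_transient {P : Matrix X X ℝ} (hP : IsRowStochastic P) {j : X}
    (hj : 0 < noReturnProb P j j) :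
    Tendsto (fun s => abelResolvent P s j j) (𝓝[<] 1) (𝓝 0) := by
  have hnum : Tendsto (fun s : ℝ => 1 - s) (𝓝[<] 1) (𝓝 0) := by
    have : Tendsto (fun s : ℝ => 1 - s) (𝓝 1) (𝓝 (1 - 1)) :=
      ((continuous_const.sub continuous_id).tendsto 1)
    rw [sub_self] at this
    exact tendsto_nhdsWithin_of_tendsto_nhds this
  have hden : Tendsto (fun s => 1 - returnTimeGF P j s j) (𝓝[<] 1)
      (𝓝 (1 - (1 - noReturnProb P j j))) := (tendsto_returnTimeGF hP j j).const_sub 1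
  have hlim := hnum.div hden (by rw [sub_sub_cancel]; exact hj.ne')
  rw [zero_div] at hlim
  refine hlim.congr' ?_
  filter_upwards [Ioo_mem_nhdsLT zero_lt_one] with s hs
  exact (abelResolvent_diag hP hs.1.le hs.2 j).symm

/-- **The monotone identity behind (4.1.5)**: for a recurrent `j` (`P(ρ_j = ∞ | X_0 = j) = 0`) and
`s ∈ [0,1)`, `1 − f̂(s)_{jj} = (1−s) Σ_m f(m)_{jj} Σ_{ℓ<m} s^ℓ` (from
`(1 − sᵐ)/(1 − s) = Σ_{ℓ<m} s^ℓ`). [cite: Stroock2014, §4.1.2 (the display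
"`(1 − f̂(s)_{jj})/(1 − s) = Σ_m (1 − sᵐ)/(1 − s) f(m)_{jj}`")] -/
theorem one_sub_returnTimeGF_eq {P : Matrix X X ℝ} (hP : IsRowStochastic P) {j : X}
    (hj : noReturnProb P j j = 0) {s : ℝ} (hs0 : 0 ≤ s) (hs1 : s < 1) :
    1 - returnTimeGF P j s j =
      (1 - s) * ∑' m : ℕ, firstPassageProb P j m j * ∑ l ∈ range m, s ^ l := by
  have hf : HasSum (fun m => firstPassageProb P j m j) 1 := by
    simpa [hj] using hasSum_firstPassageProb hP j j
  have hF := summable_returnTimeGF_term hP j hs0 hs1.le j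
  unfold returnTimeGF
  calc (1 : ℝ) - ∑' m, s ^ m * firstPassageProb P j m j
      = ∑' m, firstPassageProb P j m j - ∑' m, s ^ m * firstPassageProb P j m j := by
        rw [hf.tsum_eq]
    _ = ∑' m, (firstPassageProb P j m j - s ^ m * firstPassageProb P j m j) :=
        (hf.summable.tsum_sub hF).symm
    _ = ∑' m, (1 - s) * (firstPassageProb P j m j * ∑ l ∈ range m, s ^ l) :=
        tsum_congr fun m => by rw [mul_left_comm, mul_neg_geom_sum]; ring
    _ = (1 - s) * ∑' m, firstPassageProb P j m j * ∑ l ∈ range m, s ^ l := tsum_mul_left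

/-- The terms `f(m)_{jj} Σ_{ℓ<m} s^ℓ` are dominated by `m f(m)_{jj}` for `s ∈ [0,1]`.
[cite: Stroock2014, §4.1.2 ("`(1 − sᵐ)/(1 − s) = Σ_{ℓ<m} s^ℓ ↗ m`")] -/
theorem firstPassageProb_mul_geom_sum_le {P : Matrix X X ℝ} (hP : IsRowStochastic P) (j : X)
    {s : ℝ} (hs0 : 0 ≤ s) (hs1 : s ≤ 1) (m : ℕ) :
    firstPassageProb P j m j * ∑ l ∈ range m, s ^ l ≤ (m : ℝ) * firstPassageProb P j m j := by
  rw [mul_comm]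
  refine mul_le_mul_of_nonneg_right ?_ (firstPassageProb_nonneg hP j m j)
  calc ∑ l ∈ range m, s ^ l ≤ ∑ l ∈ range m, (1 : ℝ) := sum_le_sum fun l _ => pow_le_one₀ hs0 hs1
    _ = m := by simp

/-- **(4.1.5), positive recurrent case**: if `j` is recurrent and `E[ρ_j | X_0 = j] = Σ_m m f(m)_{jj}
= E < ∞`, then `R(s)_{jj} → E⁻¹ = π_{jj}` as `s ↗ 1` (monotone convergence
`(1 − f̂(s)_{jj})/(1−s) ↗ E`). [cite: Stroock2014, §4.1.2 eq. (4.1.5) ("if `j` is recurrent … the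
monotone convergence theorem says …")] -/
theorem Stroock2014_eq_4_1_5_posRecurrent {P : Matrix X X ℝ} (hP : IsRowStochastic P) {j : X}
    (hj : noReturnProb P j j = 0) {E : ℝ}
    (hE : HasSum (fun m : ℕ => (m : ℝ) * firstPassageProb P j m j) E) :
    Tendsto (fun s => abelResolvent P s j j) (𝓝[<] 1) (𝓝 E⁻¹) := by
  have hf : HasSum (fun m => firstPassageProb P j m j) 1 := by
    simpa [hj] using hasSum_firstPassageProb hP j j
  -- `E ≥ 1 > 0`
  have hE1 : 1 ≤ E := by
    refine hasSum_le (fun m => ?_) hf hE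
    rcases m with _ | m
    · simp [firstPassageProb_zero]
    · exact le_mul_of_one_le_left (firstPassageProb_nonneg hP j _ j) (by simp)
  -- `g(s) = Σ_m f(m) Σ_{ℓ<m} s^ℓ → E`
  have hg : Tendsto (fun s : ℝ => ∑' m : ℕ, firstPassageProb P j m j * ∑ l ∈ range m, s ^ l)
      (𝓝[<] 1) (𝓝 E) := by
    rw [← hE.tsum_eq]
    refine tendsto_tsum_of_dominated_convergence (bound := fun m : ℕ => (m : ℝ) * firstPassageProb P j m j)
      hE.summable (fun m => ?_) ?_
    · have hc : Continuous fun s : ℝ => firstPassageProb P j m j * ∑ l ∈ range m, s ^ l :=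
        continuous_const.mul (continuous_finsetSum _ fun l _ => continuous_pow l)
      have := hc.tendsto 1
      simp only [one_pow, sum_const, card_range, nsmul_eq_mul, mul_one] at this
      rw [mul_comm] at this
      exact tendsto_nhdsWithin_of_tendsto_nhds this
    · filter_upwards [Ioo_mem_nhdsLT zero_lt_one] with s hs m
      rw [Real.norm_eq_abs, abs_of_nonneg (mul_nonneg (firstPassageProb_nonneg hP j m j)
        (sum_nonneg fun l _ => pow_nonneg hs.1.le l))]
      exact firstPassageProb_mul_geom_sum_le hP j hs.1.le hs.2.le m
  refine (hg.inv₀ (by linarith)).congr' ?_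
  filter_upwards [Ioo_mem_nhdsLT zero_lt_one] with s hs
  rw [abelResolvent_diag hP hs.1.le hs.2 j, one_sub_returnTimeGF_eq hP hj hs.1.le hs.2,
    div_mul_eq_div_div, div_self (sub_pos.mpr hs.2).ne', one_div]

/-- **(4.1.5), the formal null-recurrent case**: if `j` is recurrent and `Σ_m m f(m)_{jj} = ∞`
(`E[ρ_j | X_0 = j] = ∞`), then `R(s)_{jj} → 0 = π_{jj}` as `s ↗ 1` (vacuous for finite chains,
where recurrent states are positive recurrent, but part of the printed dichotomy).
[cite: Stroock2014, §4.1.2 eq. (4.1.5)] -/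
theorem Stroock2014_eq_4_1_5_nullRecurrent {P : Matrix X X ℝ} (hP : IsRowStochastic P) {j : X}
    (hj : noReturnProb P j j = 0)
    (hE : ¬ Summable fun m : ℕ => (m : ℝ) * firstPassageProb P j m j) :
    Tendsto (fun s => abelResolvent P s j j) (𝓝[<] 1) (𝓝 0) := by
  have h0 : ∀ m : ℕ, 0 ≤ (m : ℝ) * firstPassageProb P j m j :=
    fun m : ℕ => mul_nonneg (Nat.cast_nonneg m) (firstPassageProb_nonneg hP j m j)
  have hdiv := (not_summable_iff_tendsto_nat_atTop_of_nonneg h0).mp hE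
  -- `g(s) → ∞`
  have hg : Tendsto (fun s : ℝ => ∑' m : ℕ, firstPassageProb P j m j * ∑ l ∈ range m, s ^ l)
      (𝓝[<] 1) atTop := by
    refine tendsto_atTop.mpr fun K => ?_
    obtain ⟨N, hN⟩ := (tendsto_atTop.mp hdiv (K + 1)).exists
    -- the partial sum up to `N` is continuous in `s` and tends to `Σ_{m<N} m f(m) ≥ K + 1`
    have hc : Continuous fun s : ℝ =>
        ∑ m ∈ range N, firstPassageProb P j m j * ∑ l ∈ range m, s ^ l :=
      continuous_finsetSum _ fun m _ =>
        continuous_const.mul (continuous_finsetSum _ fun l _ => continuous_pow l)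
    have hlim := hc.tendsto 1
    simp only [one_pow, sum_const, card_range, nsmul_eq_mul, mul_one] at hlim
    have hev : ∀ᶠ s : ℝ in 𝓝 1,
        K < ∑ m ∈ range N, firstPassageProb P j m j * ∑ l ∈ range m, s ^ l := by
      refine hlim.eventually (eventually_gt_nhds ?_)
      calc K < K + 1 := lt_add_one K
        _ ≤ ∑ m ∈ range N, (m : ℝ) * firstPassageProb P j m j := hN
        _ = ∑ m ∈ range N, firstPassageProb P j m j * m := sum_congr rfl fun m _ => mul_comm _ _
    filter_upwards [Ioo_mem_nhdsLT zero_lt_one, eventually_nhdsWithin_of_eventually_nhds hev]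
      with s hs hsK
    have hterm0 : ∀ m, 0 ≤ firstPassageProb P j m j * ∑ l ∈ range m, s ^ l := fun m =>
      mul_nonneg (firstPassageProb_nonneg hP j m j) (sum_nonneg fun l _ => pow_nonneg hs.1.le l)
    have hsum : Summable fun m : ℕ => firstPassageProb P j m j * ∑ l ∈ range m, s ^ l := by
      refine Summable.of_nonneg_of_le hterm0 (fun m => ?_)
        ((hasSum_firstPassageProb hP j j).summable.mul_right (1 - s)⁻¹)
      refine mul_le_mul_of_nonneg_left ?_ (firstPassageProb_nonneg hP j m j)
      rw [← tsum_geometric_of_lt_one hs.1.le hs.2]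
      exact (summable_geometric_of_lt_one hs.1.le hs.2).sum_le_tsum _ (fun l _ => pow_nonneg hs.1.le l)
    exact hsK.le.trans (hsum.sum_le_tsum _ (fun m _ => hterm0 m))
  refine hg.inv_tendsto_atTop.congr' ?_
  filter_upwards [Ioo_mem_nhdsLT zero_lt_one] with s hs
  rw [abelResolvent_diag hP hs.1.le hs.2 j, one_sub_returnTimeGF_eq hP hj hs.1.le hs.2,
    div_mul_eq_div_div, div_self (sub_pos.mpr hs.2).ne', one_div, Pi.inv_apply]

/-- **(4.1.5), off-diagonal entries**: if `R(s)_{jj} → π_{jj}` then, for `i ≠ j`,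
`R(s)_{ij} = f̂(s)_{ij}R(s)_{jj} → P(ρ_j < ∞ | X_0 = i)·π_{jj}` as `s ↗ 1`.
[cite: Stroock2014, §4.1.2 eq. (4.1.5) ("when `i ≠ j`, `R(s)_{ij} = f̂(s)_{ij}R(s)_{jj} ↗
P(ρ_j < ∞ | X_0 = i)π_{jj}`")] -/
theorem Stroock2014_eq_4_1_5_offDiag {P : Matrix X X ℝ} (hP : IsRowStochastic P) {i j : X}
    (hij : i ≠ j) {c : ℝ} (hjj : Tendsto (fun s => abelResolvent P s j j) (𝓝[<] 1) (𝓝 c)) :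
    Tendsto (fun s => abelResolvent P s i j) (𝓝[<] 1) (𝓝 ((1 - noReturnProb P j i) * c)) := by
  refine ((tendsto_returnTimeGF hP j i).mul hjj).congr' ?_
  filter_upwards [Ioo_mem_nhdsLT zero_lt_one] with s hs
  exact (abelResolvent_offDiag hP hs.1.le hs.2 hij).symm

end Literature.Probability.MarkovChains
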